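import Literature.RepresentationTheory.Semisimple.IsotypicProjection
import Mathlib.Algebra.CharP.Reduced
import Mathlib.Algebra.DirectSum.Module
import HarnessLib

/-!
# Brauer–Nesbitt over an algebraically closed field (Bourbaki, A VIII § 20 n° 6, Thm. 2)

Topic `Literature/RepresentationTheory/Semisimple`.  The case "`K` algébriquement clos" of
Bourbaki's proof of *Algèbre* VIII, § 20 n° 6, Thm. 2 with Cor. 1 (p. 378): for a field `k`
that is algebraically closed, a `k`-algebra `R`, a `k`-spanning subset `𝒜 ⊆ R` and two
*semisimple* `R`-modules `M`, `N` of finite dimension over `k` such that every `a ∈ 𝒜` has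
the same characteristic polynomial on `M` and on `N`, there is an `R`-linear isomorphism
`M ≃ N` (`Module.nonempty_linearEquiv_of_charpoly_smul_eq_of_isAlgClosed`, **proved**).  The
general field is treated in the file `BrauerNesbitt` by extension of scalars, as in loc. cit.

Proof, following Bourbaki (translated from the Grothendieck group `R_K(A)` to modules): the
traces agree on all of `R` (linearity; file `CharpolySubquotient`).  Induction on `dim_k M`.
If some simple `S ⊆ M` maps non-trivially to `N`, cancel it
(`Module.nonempty_linearEquiv_of_cancel_simple`).  Otherwise ("`θ(x) = 0`, d'où
`x ∈ p R_K(A)`", via Prop. 6 and its corollary, p. 376): for every isotypic component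
`M_S ≅ S^m` of `M` one has `m = 0` in `k` (`Module.natCast_eq_zero_of_linearEquiv_fun`: an
element `r ∈ R` acting as the isotypic projection, file `IsotypicProjection`, gives
`Tr_M(t r) = m Tr_S(t)` and `Tr_N(t r) = 0`, and some `t` has `Tr_S(t) = 1` by Schur and
density), and likewise for `N`.  In characteristic `0` this forces `M = N = 0`; in
characteristic `p` all multiplicities are divisible by `p`, so `M ≃ M₁^p`, `N ≃ N₁^p`
(`Module.exists_linearEquiv_fin_fun`), `χ_{M₁}(a)^p = χ_M(a) = χ_N(a) = χ_{N₁}(a)^p`, hence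
`χ_{M₁}(a) = χ_{N₁}(a)` as `k[X]` is reduced ("`(χ_a(y) - 1)^p = 0`, d'où `χ_a(y) = 1`
puisque l'anneau `K[[T]]` est intègre"), and `M₁ ≃ N₁` by induction ("par récurrence …
`x ∈ p^n R_K(A)` pour tout `n`").

## References

* N. Bourbaki, *Algèbre, Chapitre VIII*, 2ᵉ éd., Springer (2012), § 20 n° 6, Thm. 2 and
  Cor. 1 (pp. 377–378). [BourbakiAlgebreVIII2012]
* C. W. Curtis, I. Reiner, *Representation Theory of Finite Groups and Associative Algebras*
  (1962), (30.16) (the classical source for finite groups; not consulted).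
-/

noncomputable section

open Module Polynomial

namespace Literature.RepresentationTheory.Semisimple

universe u v w w'

variable {k : Type u} [Field k] {R : Type v} [Ring R] [Algebra k R]
  {M : Type w} [AddCommGroup M] [Module k M] [Module R M] [IsScalarTower k R M]
  [FiniteDimensional k M]
  {N : Type w'} [AddCommGroup N] [Module k N] [Module R N] [IsScalarTower k R N]
  [FiniteDimensional k N]

/-! ### Multiplicities vanish in `k` when there is no common constituent -/

/-- **Multiplicities are zero in `k`.**  Let `k` be algebraically closed, `M`, `N` semisimple
with `Tr_M = Tr_N` on `R` and such that no simple submodule of `M` maps non-trivially to `N`.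
If an isotypic component `c` of `M` is `R`-isomorphic to `S^n` (`S ⊆ c` simple), then `n = 0`
in `k`.  (Bourbaki: the characters of the simple modules are linearly independent, Prop. 6,
so `θ(x) = 0` forces `x ∈ p R_K(A)`, cor. b), p. 376.)
[cite: BourbakiAlgebreVIII2012, VIII § 20 n° 6, Prop. 6 and Cor. (pp. 375–376)] -/
theorem Module.natCast_eq_zero_of_linearEquiv_fun [IsAlgClosed k] [IsSemisimpleModule R M]
    [IsSemisimpleModule R N]
    (htr : ∀ r : R, LinearMap.trace k M (DistribSMul.toLinearMap k M r) =
      LinearMap.trace k N (DistribSMul.toLinearMap k N r))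
    (hMN : ∀ (S : Submodule R M), IsSimpleModule R S → ∀ f : S →ₗ[R] N, f = 0)
    {c : Submodule R M} (hc : c ∈ isotypicComponents R M) {S : Submodule R M}
    [IsSimpleModule R S] (hSc : S ≤ c) {n : ℕ} (e : c ≃ₗ[R] (Fin n → S)) : (n : k) = 0 := by
  have hcS : c = isotypicComponent R M S := eq_isotypicComponent_of_le hc hSc
  subst hcS
  obtain ⟨r, h1, h2, h3⟩ := Module.exists_smul_isotypicProjection k S (hMN S inferInstance)
  haveI := Module.finiteDimensional_submodule_tower (k := k) S
  haveI := Module.finiteDimensional_submodule_tower (k := k) (isotypicComponent R M S)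
  obtain ⟨t, ht⟩ := Module.exists_trace_smul_eq_one (k := k) (R := R) S
  have key := Module.trace_smul_mul_eq_trace_isotypicComponent (k := k) S h2 h3 t
  have hN : DistribSMul.toLinearMap k N (t * r) = 0 :=
    LinearMap.ext fun y ↦ by rw [DistribSMul.toLinearMap_apply, mul_smul, h1, smul_zero]; rfl
  rw [htr, hN, map_zero, Module.trace_smul_eq_of_linearEquiv (k := k) e t,
    Module.trace_smul_pi (k := k) t n, ht, nsmul_eq_mul, mul_one] at key
  exact key.symm

/-! ### Dividing a semisimple module by `p` -/

/-- **Extracting a `p`-th root of a semisimple module.**  If every isotypic component of the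
semisimple module `M` (finite-dimensional over `k`) is `S^n` with `p ∣ n`, then `M ≃ M₁^p` for
a semisimple `M₁` of finite dimension over `k` (namely `M₁ = ⨁_S S^{n_S/p}`).  (Bourbaki:
"`x = p y`" in the free `ℤ`-module `R_K(A)`.) [cite: BourbakiAlgebreVIII2012, VIII § 20 n° 6, Thm. 2 (p. 377)] -/
theorem Module.exists_linearEquiv_fin_fun [IsSemisimpleModule R M] (p : ℕ)
    (hdiv : ∀ c ∈ isotypicComponents R M, ∀ (S : Submodule R M), IsSimpleModule R S → S ≤ c →
      ∀ n : ℕ, Nonempty (c ≃ₗ[R] (Fin n → S)) → p ∣ n) :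
    ∃ (M₁ : Type w) (_ : AddCommGroup M₁) (_ : Module k M₁) (_ : Module R M₁)
      (_ : IsScalarTower k R M₁) (_ : FiniteDimensional k M₁) (_ : IsSemisimpleModule R M₁),
      Nonempty (M ≃ₗ[R] (Fin p → M₁)) := by
  classical
  haveI : Module.Finite R M := Module.Finite.of_restrictScalars_finite k R M
  set ι : Set (Submodule R M) := isotypicComponents R M with hι
  haveI : Finite ι := inferInstance
  haveI : Fintype ι := Fintype.ofFinite ι
  -- each isotypic component is `(S_c^{q_c})^p`
  have hdec : ∀ c : ι, ∃ (S : Submodule R M) (_ : IsSimpleModule R S) (q : ℕ),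
      Nonempty (c.1 ≃ₗ[R] (Fin p → (Fin q → S))) := by
    intro c
    obtain ⟨n, hn, S, hSc, hS, ⟨e⟩⟩ :=
      IsIsotypic.submodule_linearEquiv_fun (m := c.1) (IsIsotypic.isotypicComponents c.2)
    haveI := hS
    obtain ⟨q, rfl⟩ := hdiv c.1 c.2 S hS hSc n ⟨e⟩
    exact ⟨S, hS, q, ⟨e.trans ((LinearEquiv.funCongrLeft R S finProdFinEquiv).trans
      (LinearEquiv.curry R S (Fin p) (Fin q)))⟩⟩
  choose S hS q e using hdec
  haveI : ∀ c, IsSimpleModule R (S c) := hS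
  haveI : ∀ c, FiniteDimensional k (S c) := fun c ↦
    Module.finiteDimensional_submodule_tower (k := k) (S c)
  -- `M = ⨁_c c`
  have hind : iSupIndep (fun c : ι ↦ (c.1 : Submodule R M)) :=
    (sSupIndep_iff ι).mp (sSupIndep_isotypicComponents R M)
  have htop : (⨆ c : ι, (c.1 : Submodule R M)) = ⊤ := by
    rw [← sSup_eq_iSup', hι, sSup_isotypicComponents]
  have hint : DirectSum.IsInternal (fun c : ι ↦ (c.1 : Submodule R M)) :=
    DirectSum.isInternal_submodule_of_iSupIndep_of_iSup_eq_top hind htop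
  let e₀ : M ≃ₗ[R] (Π c : ι, (c.1 : Submodule R M)) :=
    (LinearEquiv.ofBijective (DirectSum.coeLinearMap fun c : ι ↦ (c.1 : Submodule R M))
        hint).symm.trans
      (DirectSum.linearEquivFunOnFintype R ι fun c : ι ↦ (c.1 : Submodule R M))
  -- swap the two products
  let sw : (Π c : ι, Fin p → (Fin (q c) → S c)) ≃ₗ[R] (Fin p → Π c : ι, (Fin (q c) → S c)) :=
    { toFun := fun f i c ↦ f c i
      invFun := fun g c i ↦ g i c
      map_add' := fun _ _ ↦ rfl
      map_smul' := fun _ _ ↦ rfl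
      left_inv := fun _ ↦ rfl
      right_inv := fun _ ↦ rfl }
  exact ⟨(Π c : ι, (Fin (q c) → S c)), inferInstance, inferInstance, inferInstance,
    inferInstance, inferInstance, inferInstance,
    ⟨e₀.trans ((LinearEquiv.piCongrRight fun c ↦ (e c).some).trans sw)⟩⟩

/-! ### The theorem over an algebraically closed field -/

/-- Induction carrier for `Module.nonempty_linearEquiv_of_charpoly_smul_eq_of_isAlgClosed`
(induction on `dim_k M`, both modules varying in fixed universes). [folklore] -/
theorem Module.nonempty_linearEquiv_of_charpoly_smul_eq_of_isAlgClosed_aux [IsAlgClosed k]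
    {𝒜 : Set R} (h𝒜 : Submodule.span k 𝒜 = ⊤) (n : ℕ) :
    ∀ (M : Type w) (N : Type w') [AddCommGroup M] [Module k M] [Module R M]
      [IsScalarTower k R M] [FiniteDimensional k M] [IsSemisimpleModule R M]
      [AddCommGroup N] [Module k N] [Module R N] [IsScalarTower k R N]
      [FiniteDimensional k N] [IsSemisimpleModule R N],
      finrank k M < n →
      (∀ a ∈ 𝒜, (DistribSMul.toLinearMap k M a).charpoly =
        (DistribSMul.toLinearMap k N a).charpoly) →
      Nonempty (M ≃ₗ[R] N) := by
  induction n with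
  | zero => intro M N _ _ _ _ _ _ _ _ _ _ _ _ hM _; exact absurd hM (Nat.not_lt_zero _)
  | succ n ih =>
    intro M N _ _ _ _ _ _ _ _ _ _ _ _ hM h
    have hdim : finrank k M = finrank k N := Module.finrank_eq_of_charpoly_smul_eq h𝒜 h
    by_cases hA : ∃ (S : Submodule R M), IsSimpleModule R S ∧ ∃ f : S →ₗ[R] N, f ≠ 0
    · -- cancellation of a common simple constituent
      obtain ⟨S, hS, f, hf⟩ := hA
      haveI := hS
      exact Module.nonempty_linearEquiv_of_cancel_simple (k := k) h S f hf
        fun P P' _ _ _ _ _ _ _ _ _ _ _ _ hP hPP' ↦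
          ih P P' (lt_of_lt_of_le hP (Nat.lt_succ_iff.mp hM)) hPP'
    -- no common constituent
    push Not at hA
    rcases subsingleton_or_nontrivial M with hM0 | hM0
    · haveI : Subsingleton N := by
        rw [Module.finrank_zero_of_subsingleton] at hdim
        exact Module.finrank_zero_iff.mp hdim.symm
      exact ⟨LinearEquiv.ofSubsingleton M N⟩
    have htr := Module.trace_smul_eq_of_charpoly_smul_eq (k := k) h𝒜 h
    have hB : ∀ (T : Submodule R N), IsSimpleModule R T → ∀ f : T →ₗ[R] M, f = 0 :=
      fun T hT f ↦ by haveI := hT; exact Module.forall_linearMap_eq_zero_symm hA T f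
    -- all multiplicities vanish in `k`
    have hmultM : ∀ c ∈ isotypicComponents R M, ∀ (S : Submodule R M), IsSimpleModule R S →
        S ≤ c → ∀ m : ℕ, Nonempty (c ≃ₗ[R] (Fin m → S)) → (m : k) = 0 :=
      fun c hc S hS hSc m ⟨e⟩ ↦ by
        haveI := hS
        exact Module.natCast_eq_zero_of_linearEquiv_fun (k := k) htr hA hc hSc e
    have hmultN : ∀ c ∈ isotypicComponents R N, ∀ (S : Submodule R N), IsSimpleModule R S →
        S ≤ c → ∀ m : ℕ, Nonempty (c ≃ₗ[R] (Fin m → S)) → (m : k) = 0 :=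
      fun c hc S hS hSc m ⟨e⟩ ↦ by
        haveI := hS
        exact Module.natCast_eq_zero_of_linearEquiv_fun (k := k) (fun r ↦ (htr r).symm) hB
          hc hSc e
    -- hence the characteristic is a prime `p`
    obtain ⟨p, hp⟩ := CharP.exists k
    have hp0 : p ≠ 0 := by
      classical
      have hne : (isotypicComponents R M).Nonempty := by
        by_contra hempty
        rw [Set.not_nonempty_iff_eq_empty] at hempty
        have htop := sSup_isotypicComponents R M
        rw [hempty, sSup_empty] at htop
        exact bot_ne_top htop
      obtain ⟨c, hc⟩ := hne
      haveI : Module.Finite R M := Module.Finite.of_restrictScalars_finite k R M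
      haveI : Nontrivial c := Submodule.nontrivial_iff_ne_bot.mpr (bot_lt_isotypicComponents hc).ne'
      obtain ⟨m, hm, S, hSc, hS, ⟨e⟩⟩ :=
        IsIsotypic.submodule_linearEquiv_fun (m := c) (IsIsotypic.isotypicComponents hc)
      have h0 : (m : k) = 0 := hmultM c hc S hS hSc m ⟨e⟩
      rw [CharP.cast_eq_zero_iff k p] at h0
      rintro rfl
      exact hm.out (Nat.eq_zero_of_zero_dvd h0)
    haveI : Fact p.Prime := ⟨CharP.char_prime_of_ne_zero k hp0⟩
    -- Frobenius descent: `M ≃ M₁^p`, `N ≃ N₁^p`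
    obtain ⟨M₁, _, _, _, _, _, _, ⟨eM⟩⟩ := Module.exists_linearEquiv_fin_fun (k := k) (M := M) p
      fun c hc S hS hSc m hm ↦ (CharP.cast_eq_zero_iff k p m).mp (hmultM c hc S hS hSc m hm)
    obtain ⟨N₁, _, _, _, _, _, _, ⟨eN⟩⟩ := Module.exists_linearEquiv_fin_fun (k := k) (M := N) p
      fun c hc S hS hSc m hm ↦ (CharP.cast_eq_zero_iff k p m).mp (hmultN c hc S hS hSc m hm)
    have h1 : ∀ a ∈ 𝒜, (DistribSMul.toLinearMap k M₁ a).charpoly =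
        (DistribSMul.toLinearMap k N₁ a).charpoly := by
      intro a ha
      haveI : ExpChar k[X] p := ExpChar.prime (Fact.out : p.Prime)
      apply frobenius_inj k[X] p
      rw [frobenius_def, frobenius_def, ← Module.charpoly_smul_pi (k := k) a p,
        ← Module.charpoly_smul_pi (k := k) a p, ← Module.charpoly_smul_eq_of_linearEquiv (k := k) eM a,
        ← Module.charpoly_smul_eq_of_linearEquiv (k := k) eN a, h a ha]
    have hdim1 : finrank k M₁ < n := by
      have e1 := (eM.restrictScalars k).finrank_eq
      rw [Module.finrank_pi_fintype, Finset.sum_const, Finset.card_univ, Fintype.card_fin,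
        smul_eq_mul] at e1
      have hMpos : 0 < finrank k M := Module.finrank_pos
      have hp2 : 2 ≤ p := (Fact.out : p.Prime).two_le
      have hMn : finrank k M ≤ n := Nat.lt_succ_iff.mp hM
      nlinarith
    obtain ⟨e₁⟩ := ih M₁ N₁ hdim1 h1
    exact ⟨eM.trans ((LinearEquiv.piCongrRight fun _ ↦ e₁).trans eN.symm)⟩

/-- **Brauer–Nesbitt over an algebraically closed field** (Bourbaki, *Algèbre* VIII, § 20
n° 6, Thm. 2 with Cor. 1, case "`K` algébriquement clos"): let `k` be an algebraically closed
field, `R` a `k`-algebra, `𝒜 ⊆ R` a subset spanning `R` over `k`, and `M`, `N` semisimple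
`R`-modules of finite dimension over `k` such that for every `a ∈ 𝒜` the characteristic
polynomials of `a_M` and `a_N` coincide.  Then `M` and `N` are isomorphic `R`-modules.
[cite: BourbakiAlgebreVIII2012, VIII § 20 n° 6, Thm. 2 and Cor. 1 (pp. 377–378)] -/
theorem Module.nonempty_linearEquiv_of_charpoly_smul_eq_of_isAlgClosed [IsAlgClosed k]
    [IsSemisimpleModule R M] [IsSemisimpleModule R N] {𝒜 : Set R}
    (h𝒜 : Submodule.span k 𝒜 = ⊤)
    (h : ∀ a ∈ 𝒜, (DistribSMul.toLinearMap k M a).charpoly =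
      (DistribSMul.toLinearMap k N a).charpoly) :
    Nonempty (M ≃ₗ[R] N) :=
  Module.nonempty_linearEquiv_of_charpoly_smul_eq_of_isAlgClosed_aux h𝒜 (finrank k M + 1) M N
    (Nat.lt_succ_self _) h

end Literature.RepresentationTheory.Semisimple
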